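import Mathlib
import Summits.Ventures.HodgeRepro.Tier4.Common.TestProjector
import Summits.Ventures.HodgeRepro.Tier4.Line1.PairOrbitalBumps
import Summits.Ventures.HodgeRepro.Tier4.Line1.IrreducibleSubspace
import Summits.Ventures.HodgeRepro.Tier4.Line4.MaximalFamilyClosed

/-!
# Tier4/Common/ProjectorStability — a CLOSED invariant subspace is stable under the `K`-type projector `e_{C,χ}`
(the approximate-identity argument)

Blind re-derivation cell `pub-hodge-repro`, Tier 4 «prove the step» (README §9–§10), seat t4-typer-2 (gen 3).
Target tree path `lean/Summits/Ventures/HodgeRepro/Tier4/Common/ProjectorStability.lean`.  Mathlib +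
`Common.TestProjector` (`lProj`, `integral_lProj_mul_eq`: `R(e ⋆ δ) = e ∘ R(δ)`), `Line1.PairOrbitalBumps`
(`RTF.Setting.exists_bump`, a Urysohn bump), `Line1.IrreducibleSubspace` (`continuous_R_of_invariant`),
`Line4.MaximalFamilyClosed` (`IsClosedSub`); no literature.

WHY (t4-L4-p1 S14029 (δ), `KTypeOfPeriod.hasKTypeAt_of_period_ne_zero`'s displayed `hstab : e f ∈ V`: «the
approximate-identity argument is the honest proof»): for a closed (`IsClosedSub`) invariant subspace `V` of the
setting, a compact subgroup `C` with Haar probability `ν` and a continuous unitary character `χ` of `C`, the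
projector `e = e_{C,χ}` maps `V` into `V`.  The proof is the classical one — `e ψ` is the `L²(D_G)`-limit of
`R(e ⋆ δ_U) ψ ∈ V` as the open neighbourhood `U` of `1` shrinks (`δ_U` a continuous non-negative bump of integral
`1` supported in `U`):
* `exists_open_nhds_one_norm_sub_lt` — uniform continuity of the right translates on a compact (the tube lemma);
* `exists_approxIdentity` — the normalised bump `δ_U`;
* `norm_integral_approx_sub_le` — `‖R(δ_U) ψ (x) − ψ(x)‖ ≤ ε` when `ψ` oscillates by `≤ ε` on `x U`;
* `norm_kProj_le` — `e` is a contraction for the sup norm on `x C`;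
* `invariant_kProj` — `e` preserves left `G(k)`-invariance;
* **`kProj_mem_of_isClosedSub`** — `ψ ∈ V → e_{C,χ} ψ ∈ V` (`R(e ⋆ δ_U) ψ = e (R(δ_U) ψ)` by
  `integral_lProj_mul_eq`, the difference `e(ψ − R(δ_U)ψ)` is `≤ ε` on `D_G` since `closure D_G · C` is compact, and
  `IsClosedSub` closes);
* `kProj_mem_span_of_isClosedSub` — the `Submodule.span` form consumed by the `HasKTypeAt` clauses.

Nothing here says anything about the status of the Hodge conjecture for CM abelian varieties, which is NOT proved
(HC_CM is NOT proved by anyone in this repository).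
-/

set_option autoImplicit false

noncomputable section

namespace Summit.Ventures.HodgeRepro.Tier4.Common

open MeasureTheory Topology Summit.Ventures.HodgeRepro.Tier4.Line1
open scoped Pointwise ComplexConjugate

section ApproxIdentity

variable {G : Type} [Group G] [TopologicalSpace G] [IsTopologicalGroup G]

/-- **Uniform continuity of the right translates on a compact**: for continuous `ψ`, compact `K` and `ε > 0` there is
an open neighbourhood `U` of `1` with `‖ψ (x y) − ψ x‖ < ε` for all `x ∈ K`, `y ∈ U` (the tube lemma on `K × {1}`). -/
theorem exists_open_nhds_one_norm_sub_lt {ψ : G → ℂ} (hψ : Continuous ψ) {K : Set G} (hK : IsCompact K) {ε : ℝ}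
    (hε : 0 < ε) : ∃ U : Set G, IsOpen U ∧ (1 : G) ∈ U ∧ ∀ x ∈ K, ∀ y ∈ U, ‖ψ (x * y) - ψ x‖ < ε := by
  let n : Set (G × G) := {p | ‖ψ (p.1 * p.2) - ψ p.1‖ < ε}
  have hn : IsOpen n :=
    isOpen_lt ((hψ.comp (continuous_fst.mul continuous_snd)).sub (hψ.comp continuous_fst)).norm continuous_const
  have hp : K ×ˢ ({1} : Set G) ⊆ n := by
    rintro ⟨x, y⟩ ⟨_, hy⟩
    rw [Set.mem_singleton_iff] at hy
    subst hy
    show ‖ψ (x * 1) - ψ x‖ < ε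
    rw [mul_one, sub_self, norm_zero]
    exact hε
  obtain ⟨u, v, -, hv, hKu, h1v, huv⟩ := generalized_tube_lemma hK isCompact_singleton hn hp
  refine ⟨v, hv, h1v rfl, fun x hx y hy => ?_⟩
  have h := huv (Set.mk_mem_prod (hKu hx) hy)
  exact h

variable [MeasurableSpace G] [BorelSpace G]

/-- **An approximate identity**: for an open neighbourhood `U` of `1` there is a continuous `δ ≥ 0` with compact
support, vanishing outside `U`, of Haar integral `1`. -/
theorem exists_approxIdentity [LocallyCompactSpace G] (μ : Measure G) [μ.IsHaarMeasure] {U : Set G}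
    (hU : IsOpen U) (h1 : (1 : G) ∈ U) :
    ∃ δ : G → ℝ, Continuous δ ∧ HasCompactSupport δ ∧ (∀ y, 0 ≤ δ y) ∧ (∀ y, y ∉ U → δ y = 0) ∧
      ∫ y, δ y ∂μ = 1 := by
  obtain ⟨b, hbc, hbs, hbU, hb0, -, hb1⟩ := RTF.Setting.exists_bump (G := G) hU h1
  have hpos : 0 < ∫ y, b y ∂μ :=
    hbc.integral_pos_of_hasCompactSupport_nonneg_nonzero hbs hb0 (by rw [hb1]; exact one_ne_zero)
  refine ⟨fun y => (∫ y, b y ∂μ)⁻¹ * b y, continuous_const.mul hbc,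
    hbs.comp_left (g := fun t => (∫ y, b y ∂μ)⁻¹ * t) (mul_zero _), fun y => mul_nonneg (inv_nonneg.2 hpos.le) (hb0 y),
    fun y hy => ?_, ?_⟩
  · have : b y = 0 := by
      by_contra hne
      exact hy (hbU (subset_closure hne))
    show (∫ y, b y ∂μ)⁻¹ * b y = 0
    rw [this, mul_zero]
  · rw [integral_const_mul, inv_mul_cancel₀ hpos.ne']

/-- **The approximate identity reproduces `ψ` at `x` up to the oscillation of `ψ` on `x U`**: if `δ ≥ 0` vanishes
outside `U` and has integral `1`, and `‖ψ (x y) − ψ x‖ ≤ ε` for `y ∈ U`, then `‖∫ δ(y) ψ(x y) dμ − ψ x‖ ≤ ε`. -/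
theorem norm_integral_approx_sub_le (μ : Measure G) [IsFiniteMeasureOnCompacts μ] {δ : G → ℝ} (hδc : Continuous δ)
    (hδs : HasCompactSupport δ) (hδ0 : ∀ y, 0 ≤ δ y) {U : Set G} (hδU : ∀ y, y ∉ U → δ y = 0)
    (hδ1 : ∫ y, δ y ∂μ = 1) {ψ : G → ℂ} (hψ : Continuous ψ) {x : G} {ε : ℝ}
    (hx : ∀ y ∈ U, ‖ψ (x * y) - ψ x‖ ≤ ε) :
    ‖(∫ y, (δ y : ℂ) * ψ (x * y) ∂μ) - ψ x‖ ≤ ε := by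
  have hδcC : Continuous fun y => (δ y : ℂ) := Complex.continuous_ofReal.comp hδc
  have hδsC : HasCompactSupport fun y => (δ y : ℂ) := hδs.comp_left Complex.ofReal_zero
  have hint1 : Integrable (fun y => (δ y : ℂ) * ψ (x * y)) μ :=
    (hδcC.mul (hψ.comp (continuous_const.mul continuous_id))).integrable_of_hasCompactSupport hδsC.mul_right
  have hint2 : Integrable (fun y => (δ y : ℂ) * ψ x) μ :=
    (hδcC.integrable_of_hasCompactSupport hδsC).mul_const _
  have hintε : Integrable (fun y => δ y * ε) μ := (hδc.integrable_of_hasCompactSupport hδs).mul_const _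
  have e : ∫ y, (δ y : ℂ) * (ψ (x * y) - ψ x) ∂μ = (∫ y, (δ y : ℂ) * ψ (x * y) ∂μ) - ψ x := by
    simp_rw [mul_sub]
    rw [integral_sub hint1 hint2, integral_mul_const, integral_complex_ofReal, hδ1, Complex.ofReal_one, one_mul]
  rw [← e]
  calc ‖∫ y, (δ y : ℂ) * (ψ (x * y) - ψ x) ∂μ‖ ≤ ∫ y, δ y * ε ∂μ := by
        refine norm_integral_le_of_norm_le hintε (Filter.Eventually.of_forall fun y => ?_)
        rw [norm_mul, Complex.norm_real, Real.norm_eq_abs, abs_of_nonneg (hδ0 y)]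
        by_cases hy : y ∈ U
        · exact mul_le_mul_of_nonneg_left (hx y hy) (hδ0 y)
        · rw [hδU y hy, zero_mul, zero_mul]
    _ = ε := by rw [integral_mul_const, hδ1, one_mul]

end ApproxIdentity

section Contraction

variable {G : Type} [Group G] [TopologicalSpace G] [IsTopologicalGroup G] [MeasurableSpace G] [BorelSpace G]
  (C : Subgroup G) (ν : Measure C)

omit [TopologicalSpace G] [IsTopologicalGroup G] [BorelSpace G] in
/-- **`e_{C,χ}` is a contraction for the sup norm on `x C`**: `‖e ψ (x)‖ ≤ M` when `‖ψ (x κ)‖ ≤ M` for all `κ ∈ C`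
(`ν` a probability, `|χ| = 1`). -/
theorem norm_kProj_le [IsProbabilityMeasure ν] {χ : G → ℂ} (hu : ∀ a ∈ C, ‖χ a‖ = 1) (ψ : G → ℂ) (x : G) {M : ℝ}
    (hM : ∀ κ ∈ C, ‖ψ (x * κ)‖ ≤ M) : ‖kProj C ν χ ψ x‖ ≤ M := by
  unfold kProj
  calc ‖∫ κ : C, conj (χ κ) * ψ (x * κ) ∂ν‖ ≤ ∫ _ : C, M ∂ν := by
        refine norm_integral_le_of_norm_le (integrable_const M) (Filter.Eventually.of_forall fun κ => ?_)
        rw [norm_mul, Complex.norm_conj, hu κ κ.2, one_mul]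
        exact hM κ κ.2
    _ = M := by simp

omit [IsTopologicalGroup G] [BorelSpace G] in
/-- **`e_{C,χ}` preserves left `G(k)`-invariance.** -/
theorem invariant_kProj (S : RTF.Setting G) (χ : G → ℂ) {ψ : G → ℂ} (hψ : S.Invariant ψ) :
    S.Invariant (kProj C ν χ ψ) := by
  intro γ x
  unfold kProj
  simp_rw [mul_assoc, hψ γ]

end Contraction

section Stability

variable {G : Type} [Group G] [TopologicalSpace G] [IsTopologicalGroup G] [MeasurableSpace G] [BorelSpace G]
  [LocallyCompactSpace G] [FirstCountableTopology G] [SecondCountableTopology G]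

/-- **A closed invariant subspace is stable under the `K`-type projector**: for `V` invariant (`IsInvariantSubspace`)
and closed (`IsClosedSub`), `C` a compact subgroup with Haar probability `ν`, `χ` a continuous unitary character of
`C`, `ψ ∈ V → e_{C,χ} ψ ∈ V`.  Proof: `e ψ` is continuous and invariant; for `ε > 0`, choose `U ∋ 1` on which the right
translates of `ψ` oscillate by `< ε₀ := ε / (μ(D_G)^{1/2} + 1)` over the compact `closure D_G · C`, an approximate
identity `δ` supported in `U`, and `ψ' := R(e ⋆ δ) ψ ∈ V` (`V` is `R(f)`-stable): then `ψ' = e (R(δ) ψ)`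
(`integral_lProj_mul_eq`), so `e ψ − ψ' = e (ψ − R(δ)ψ)` is bounded by `ε₀` on `D_G`, and its `L²(D_G)`-norm is
`< ε`. -/
theorem kProj_mem_of_isClosedSub (S : RTF.Setting G) {V : Set (G → ℂ)}
    (hV : S.IsInvariantSubspace V) (hcl : Line4.IsClosedSub S V) (C : Subgroup G) [CompactSpace C]
    (ν : Measure C) [ν.IsHaarMeasure] [IsProbabilityMeasure ν] {χ : G → ℂ} (hχc : Continuous fun κ : C => χ κ)
    (hχ : ∀ a ∈ C, ∀ b ∈ C, χ (a * b) = χ a * χ b) (hu : ∀ a ∈ C, ‖χ a‖ = 1) {ψ : G → ℂ} (hψ : ψ ∈ V) :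
    kProj C ν χ ψ ∈ V := by
  haveI : S.μ.IsHaarMeasure := S.haar
  have hψc : Continuous ψ := hV.cont ψ hψ
  have hψi : S.Invariant ψ := hV.inv ψ hψ
  refine hcl _ (continuous_kProj C ν hχc hψc) (invariant_kProj C ν S χ hψi) ?_
  intro ε hε
  -- the compact `closure D_G · C` and the finite measure of `D_G`
  have hCc : IsCompact (C : Set G) := isCompact_iff_compactSpace.2 inferInstance
  have hK : IsCompact (closure S.DG * (C : Set G)) := S.compG.mul hCc
  have hDG : S.μ S.DG ≠ ⊤ :=
    (lt_of_le_of_lt (measure_mono subset_closure) S.compG.measure_lt_top).ne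
  have hmne : S.μ S.DG ^ (2 : ENNReal).toReal⁻¹ ≠ ⊤ :=
    ENNReal.rpow_ne_top_of_nonneg (inv_nonneg.2 ENNReal.toReal_nonneg) hDG
  have hM0 : 0 ≤ (S.μ S.DG ^ (2 : ENNReal).toReal⁻¹).toReal := ENNReal.toReal_nonneg
  have hε₀ : 0 < ε / ((S.μ S.DG ^ (2 : ENNReal).toReal⁻¹).toReal + 1) := div_pos hε (by linarith)
  -- the oscillation neighbourhood and the approximate identity
  obtain ⟨U, hUo, hU1, hUψ⟩ := exists_open_nhds_one_norm_sub_lt hψc hK hε₀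
  obtain ⟨δ, hδc, hδs, hδ0, hδU, hδ1⟩ := exists_approxIdentity S.μ hUo hU1
  have hδcC : Continuous fun y => (δ y : ℂ) := Complex.continuous_ofReal.comp hδc
  have hδsC : HasCompactSupport fun y => (δ y : ℂ) := hδs.comp_left Complex.ofReal_zero
  -- the test function `e ⋆ δ` and the member `R(e ⋆ δ) ψ` of `V`
  have hfc : Continuous (lProj C ν χ fun y => (δ y : ℂ)) := continuous_lProj C ν hχc hδcC
  have hfs : HasCompactSupport (lProj C ν χ fun y => (δ y : ℂ)) := hasCompactSupport_lProj C ν hδsC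
  refine ⟨S.R (lProj C ν χ fun y => (δ y : ℂ)) ψ, hV.conv ψ hψ _ ⟨hfc, hfs⟩, ?_⟩
  -- `R(e ⋆ δ) ψ = e (R(δ) ψ)`, and `R(δ) ψ` is continuous
  have hR : ∀ x, S.R (lProj C ν χ fun y => (δ y : ℂ)) ψ x = kProj C ν χ (S.R (fun y => (δ y : ℂ)) ψ) x :=
    fun x => integral_lProj_mul_eq C ν S.μ hχc hχ hu hδcC hδsC hψc x
  have hRc : Continuous (S.R (fun y => (δ y : ℂ)) ψ) :=
    S.continuous_R_of_invariant ⟨hδcC, hδsC⟩ hψi hψc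
  -- the pointwise bound on `D_G`
  have hbound : ∀ x ∈ S.DG,
      ‖kProj C ν χ ψ x - S.R (lProj C ν χ fun y => (δ y : ℂ)) ψ x‖ ≤
        ε / ((S.μ S.DG ^ (2 : ENNReal).toReal⁻¹).toReal + 1) := by
    intro x hx
    rw [hR]
    have hsub := congrFun (kProj_sub C ν hχc hψc hRc) x
    rw [← hsub]
    refine norm_kProj_le C ν hu _ x fun κ hκ => ?_
    have hxκ : x * κ ∈ closure S.DG * (C : Set G) := Set.mul_mem_mul (subset_closure hx) hκ
    have := norm_integral_approx_sub_le S.μ hδc hδs hδ0 hδU hδ1 hψc (x := x * κ)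
      fun y hy => (hUψ _ hxκ y hy).le
    rw [norm_sub_rev] at this
    exact this
  -- the `L²(D_G)` bound
  calc eLpNorm (fun x => kProj C ν χ ψ x - S.R (lProj C ν χ fun y => (δ y : ℂ)) ψ x) 2 (S.μ.restrict S.DG)
      ≤ (S.μ.restrict S.DG) Set.univ ^ (2 : ENNReal).toReal⁻¹ *
          ENNReal.ofReal (ε / ((S.μ S.DG ^ (2 : ENNReal).toReal⁻¹).toReal + 1)) :=
        eLpNorm_le_of_ae_bound
          ((ae_restrict_iff'₀ S.fdG.nullMeasurableSet).2 (Filter.Eventually.of_forall hbound))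
    _ = ENNReal.ofReal ((S.μ S.DG ^ (2 : ENNReal).toReal⁻¹).toReal *
          (ε / ((S.μ S.DG ^ (2 : ENNReal).toReal⁻¹).toReal + 1))) := by
        rw [Measure.restrict_apply_univ, ENNReal.ofReal_mul hM0, ENNReal.ofReal_toReal hmne]
    _ < ENNReal.ofReal ε := by
        rw [ENNReal.ofReal_lt_ofReal_iff hε]
        have h1 : (S.μ S.DG ^ (2 : ENNReal).toReal⁻¹).toReal /
            ((S.μ S.DG ^ (2 : ENNReal).toReal⁻¹).toReal + 1) < 1 :=
          (div_lt_one (by linarith)).2 (by linarith)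
        calc (S.μ S.DG ^ (2 : ENNReal).toReal⁻¹).toReal *
              (ε / ((S.μ S.DG ^ (2 : ENNReal).toReal⁻¹).toReal + 1))
              = ε * ((S.μ S.DG ^ (2 : ENNReal).toReal⁻¹).toReal /
                  ((S.μ S.DG ^ (2 : ENNReal).toReal⁻¹).toReal + 1)) := by ring
          _ < ε * 1 := mul_lt_mul_of_pos_left h1 hε
          _ = ε := mul_one ε

/-- The `Submodule.span` form: `e_{C,χ} ψ ∈ span ℂ V` for `ψ ∈ V` closed invariant (the shape of the `HasKTypeAt`
witness clauses). -/
theorem kProj_mem_span_of_isClosedSub (S : RTF.Setting G) {V : Set (G → ℂ)}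
    (hV : S.IsInvariantSubspace V) (hcl : Line4.IsClosedSub S V) (C : Subgroup G) [CompactSpace C]
    (ν : Measure C) [ν.IsHaarMeasure] [IsProbabilityMeasure ν] {χ : G → ℂ} (hχc : Continuous fun κ : C => χ κ)
    (hχ : ∀ a ∈ C, ∀ b ∈ C, χ (a * b) = χ a * χ b) (hu : ∀ a ∈ C, ‖χ a‖ = 1) {ψ : G → ℂ} (hψ : ψ ∈ V) :
    kProj C ν χ ψ ∈ Submodule.span ℂ V :=
  Submodule.subset_span (kProj_mem_of_isClosedSub S hV hcl C ν hχc hχ hu hψ)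

/-- **The span form for members of the span** (the exact shape of L4's `hstab` binder on `V := span ℂ U`): for `U`
closed invariant and `f ∈ span ℂ U`, `e_{C,χ} f ∈ span ℂ U` — by linearity of `e` (`kProj_add`, `kProj_const_mul`,
`kProj_zero`) and `kProj_mem_of_isClosedSub` on the generators (`Submodule.span_induction`). -/
theorem kProj_mem_span_of_mem_span (S : RTF.Setting G) {U : Set (G → ℂ)}
    (hU : S.IsInvariantSubspace U) (hcl : Line4.IsClosedSub S U) (C : Subgroup G) [CompactSpace C]
    (ν : Measure C) [ν.IsHaarMeasure] [IsProbabilityMeasure ν] {χ : G → ℂ} (hχc : Continuous fun κ : C => χ κ)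
    (hχ : ∀ a ∈ C, ∀ b ∈ C, χ (a * b) = χ a * χ b) (hu : ∀ a ∈ C, ‖χ a‖ = 1) {f : G → ℂ}
    (hf : f ∈ Submodule.span ℂ U) : kProj C ν χ f ∈ Submodule.span ℂ U := by
  have key : Continuous f ∧ kProj C ν χ f ∈ Submodule.span ℂ U := by
    refine Submodule.span_induction (p := fun g _ => Continuous g ∧ kProj C ν χ g ∈ Submodule.span ℂ U)
      (fun g hg => ⟨hU.cont g hg, kProj_mem_span_of_isClosedSub S hU hcl C ν hχc hχ hu hg⟩)
      ⟨continuous_const, ?_⟩ (fun g₁ g₂ _ _ h₁ h₂ => ⟨h₁.1.add h₂.1, ?_⟩)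
      (fun c g _ h => ⟨continuous_const.mul h.1, ?_⟩) hf
    · have e : kProj C ν χ (0 : G → ℂ) = 0 := kProj_zero C ν χ
      rw [e]
      exact Submodule.zero_mem _
    · have e : kProj C ν χ (g₁ + g₂) = kProj C ν χ g₁ + kProj C ν χ g₂ := kProj_add C ν hχc h₁.1 h₂.1
      rw [e]
      exact Submodule.add_mem _ h₁.2 h₂.2
    · have e : kProj C ν χ (c • g) = c • kProj C ν χ g := kProj_const_mul C ν χ g c
      rw [e]
      exact Submodule.smul_mem _ c h.2
  exact key.2

end Stability

end Summit.Ventures.HodgeRepro.Tier4.Common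

end
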